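import Literature.MathematicalPhysics.QuantumLattice.MPSBlockedTensorSweepIterate
import Literature.MathematicalPhysics.QuantumLattice.ProductOperatorPeeling
import Summits.Ventures.CertifiedManyBodySolver.Upper.StripCellEnum
import Summits.Ventures.CertifiedManyBodySolver.Theorems.M3x2EdgeSplitUpperEdgeCellSweep
import HarnessLib

/-!
# Strip-cell certificates, bridge layer L3 in the canonical enumeration `κ₀`:
# a cell product word weighted sweep = the `c·W` one-site sweeps of the certificate verifier

HONEST FRAMING: first certified bounds; not a superconductivity verdict; every number certified or
labelled float. Pure algebra, zero row value; serves crux `UpperEdge_le_m73o100` (route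
`M3x2EdgeSplit`) only as infrastructure for the FORMAT-soundness bridge of kernel-replayed strip-cell
certificates (HOME `hubbard-upper-eng-1/eng-g26/BRIDGE-SPEC.md`, lemma groups L2–L4).

The strip-cell consumers (`Theorems.energyDensityTT'_le_of_exists_stripCellCert₂` …) read cell
operators through an enumeration `κ` of the cell configurations; certificate files use the canonical
`κ₀ = stripCellEnum c W` (little-endian base-4 digits along the column-major in-cell site index
`cellSiteIndex`, `Upper/StripCellEnum.lean`), and their verifier evaluates the dual matrix by ONE-SITE
SWEEPS over the `N = c·W` in-cell sites for a cell tensor given site by site,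
`A(S) = k_0^{s_0} k_1^{s_1} ⋯ k_{N-1}^{s_{N-1}}` (`s_r` = digit `r` of `S`; bonds zero-padded to a
common index `β`). This file proves that this is literally the tree's object:

* `stripCellEnum_symm_eq` — `κ₀⁻¹ S = (digits of S) ∘ cellSiteIndex`;
* `superSite_stripCellEnum_productOp` — through `κ₀`, the cell product operator `⨂_f v_f`
  (`superSite κ₀ (productOp v)`) is the chain product operator `⨂_{r<N} v_{site r}` on the column-major
  index, reindexed by `finFunctionFinEquiv`;
* `opSandwich_stripCellEnum_productOp` — **the weighted sweep of the site-by-site cell tensor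
  against a cell product word is the `N`-fold iterated one-site sweep**
  `iterSweep N k (r ↦ v_{site r}) M` (site `r = 0` innermost), i.e. exactly the verifier's loop
  (`Literature…MPSBlockedTensorSweepIterate.opSandwich_wordTensor_piOp`);
* `opSandwich_stripCellEnum_sum_productOp` — the same for a finite linear combination of product
  words (how `stripCellBondMatrix`'s intra-cell part is presented to a verifier);
* `heisenberg_stripCellEnum`, `gram_stripCellEnum`, `bondImage_stripCellEnum_kronecker` — the
  tree's `Φ(Z)`, Gram matrix and bond image of a two-cell product word for the site-by-site cell
  tensor are `N`, `N` and `2N` one-site sweeps (left cell innermost).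

Not here (lemma group L4): writing `superSite κ₀ (toSpin (hubbardOpenBoxTT' …))` and
`interCellMatrix` as explicit sums of product words. 0 `sorry`, 0 `def`.
-/

namespace Summit.Ventures.CertifiedManyBodySolver.Theorems

open Matrix Literature.MathematicalPhysics.QuantumLattice Summit.Ventures.CertifiedManyBodySolver.Upper
open scoped Kronecker

variable {c W : ℕ}

/-- `κ₀⁻¹ S` is the digit string of `S` read along the column-major site index:
`(stripCellEnum c W).symm S = (finFunctionFinEquiv.symm S) ∘ (cellSiteIndex c W)`. -/
theorem stripCellEnum_symm_eq (S : Fin (4 ^ (c * W))) :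
    (stripCellEnum c W).symm S = fun f => finFunctionFinEquiv.symm S (cellSiteIndex c W f) :=
  funext fun f => stripCellEnum_symm_apply c W S f

/-- **`κ₀` reads a cell product operator as a chain product operator.** For one-site matrices
`v_f` on the cell sites, `superSite κ₀ (⨂_f v_f)` is the product operator `⨂_{r < c·W} v_{site r}` of
the chain `Fin (c·W)` (column-major site index), with configurations read as base-4 digit strings
(`finFunctionFinEquiv`). -/
theorem superSite_stripCellEnum_productOp (v : Fin c ×ₗ Fin W → Matrix (Fin 4) (Fin 4) ℂ) :
    superSite (stripCellEnum c W) (productOp v) =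
      (productOp fun r : Fin (c * W) => v ((cellSiteIndex c W).symm r)).submatrix
        finFunctionFinEquiv.symm finFunctionFinEquiv.symm := by
  ext S S'
  rw [superSite_apply, submatrix_apply, productOp_comp_equiv (cellSiteIndex c W).symm v,
    submatrix_apply, Equiv.symm_symm, stripCellEnum_symm_eq, stripCellEnum_symm_eq]
  rfl

section Sweep

variable {β : Type*} [Fintype β] [DecidableEq β]

/-- **A cell product word costs `c·W` one-site sweeps.** For a cell tensor given site by site along
the column-major index, `A(S) = k_0^{s_0} ⋯ k_{N-1}^{s_{N-1}}` (`wordTensor k` on the digit string of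
`S`), the `superSite κ₀ (⨂_f v_f)`-weighted sweep of `M` is the iterated one-site sweep
`Φ^{v_{site (N-1)}}_{k_{N-1}}(⋯ Φ^{v_{site 0}}_{k_0}(M) ⋯)`. -/
theorem opSandwich_stripCellEnum_productOp (k : Fin (c * W) → Fin 4 → Matrix β β ℂ)
    (v : Fin c ×ₗ Fin W → Matrix (Fin 4) (Fin 4) ℂ) (M : Matrix β β ℂ) :
    opSandwich (fun S => wordTensor k (finFunctionFinEquiv.symm S))
        (superSite (stripCellEnum c W) (productOp v)) M =
      iterSweep (c * W) k (fun r => v ((cellSiteIndex c W).symm r)) M := by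
  rw [superSite_stripCellEnum_productOp, ← piOp_eq_productOp,
    opSandwich_reindex finFunctionFinEquiv.symm (wordTensor k) (piOp _) M, opSandwich_wordTensor_piOp]

/-- The same for a finite linear combination `Σ_i a_i ⨂_f (v_i)_f` of cell product words: the weighted
sweep is `Σ_i a_i ·` (the `c·W`-fold iterated sweep of word `i`). -/
theorem opSandwich_stripCellEnum_sum_productOp {ι : Type*} (s : Finset ι)
    (k : Fin (c * W) → Fin 4 → Matrix β β ℂ) (a : ι → ℂ)
    (v : ι → Fin c ×ₗ Fin W → Matrix (Fin 4) (Fin 4) ℂ) (M : Matrix β β ℂ) :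
    opSandwich (fun S => wordTensor k (finFunctionFinEquiv.symm S))
        (∑ i ∈ s, a i • superSite (stripCellEnum c W) (productOp (v i))) M =
      ∑ i ∈ s, a i • iterSweep (c * W) k (fun r => v i ((cellSiteIndex c W).symm r)) M := by
  rw [opSandwich_sum_smul]
  exact Finset.sum_congr rfl fun i _ => by rw [opSandwich_stripCellEnum_productOp]

/-- The tree's Heisenberg map `Φ(Z)` of the site-by-site cell tensor is `c·W` plain one-site sweeps. -/
theorem heisenberg_stripCellEnum {D : ℕ} (k : Fin (c * W) → Fin 4 → Matrix (Fin D) (Fin D) ℂ)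
    (Z : Matrix (Fin D) (Fin D) ℂ) :
    heisenberg (fun S => wordTensor k (finFunctionFinEquiv.symm S)) Z =
      iterSweep (c * W) k (fun _ => 1) Z := by
  rw [heisenberg_eq_opSandwich, ← opSandwich_wordTensor_one,
    ← opSandwich_reindex finFunctionFinEquiv.symm (wordTensor k) 1 Z, submatrix_one_equiv]

/-- The tree's Gram matrix of the site-by-site cell tensor is `c·W` plain one-site sweeps of `1`. -/
theorem gram_stripCellEnum {D : ℕ} (k : Fin (c * W) → Fin 4 → Matrix (Fin D) (Fin D) ℂ) :
    Upper.gram (fun S => wordTensor k (finFunctionFinEquiv.symm S)) =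
      iterSweep (c * W) k (fun _ => 1) 1 := by
  rw [gram_eq_opSandwich, ← heisenberg_eq_opSandwich, heisenberg_stripCellEnum]

/-- **A two-cell product word costs `2·c·W` one-site sweeps.** The tree's bond image of
`(⨂_f a_f) ⊗ₖ (⨂_f b_f)` (left cell word `a`, right cell word `b`, both read through `κ₀`) for the
site-by-site cell tensor is the `b`-sweep chain applied to the `a`-sweep chain applied to `1`
(left cell innermost; inside each cell site `0` innermost). -/
theorem bondImage_stripCellEnum_kronecker {D : ℕ} (k : Fin (c * W) → Fin 4 → Matrix (Fin D) (Fin D) ℂ)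
    (a b : Fin c ×ₗ Fin W → Matrix (Fin 4) (Fin 4) ℂ) :
    bondImage (fun S => wordTensor k (finFunctionFinEquiv.symm S))
        (superSite (stripCellEnum c W) (productOp a) ⊗ₖ superSite (stripCellEnum c W) (productOp b)) =
      iterSweep (c * W) k (fun r => b ((cellSiteIndex c W).symm r))
        (iterSweep (c * W) k (fun r => a ((cellSiteIndex c W).symm r)) 1) := by
  rw [bondImage_kronecker, opSandwich_stripCellEnum_productOp, opSandwich_stripCellEnum_productOp]

end Sweep

end Summit.Ventures.CertifiedManyBodySolver.Theorems
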